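import Summits.BirchSwinnertonDyer.BirchSwinnertonDyer.Theorems.KatoDescentPotSupersingularSmallImageEulerSystemBoundOffP
import Summits.BirchSwinnertonDyer.BirchSwinnertonDyer.Theorems.KatoDescentPotSupersingularMemberIndexOfValue
import Summits.BirchSwinnertonDyer.BirchSwinnertonDyer.Theorems.KatoDescentPotSupersingularMemberHullRankOne
import HarnessLib

/-!
# Kato's Λ-adic divisibility `char X₀(W/ℚ_∞) ∣ char(𝐇¹_Γ/Λ𝐲)` for KATO'S OWN zeta class `𝐲` on the REDUCIBLE
# non-CM rank-0 rows — assembled from general named facts {Kato 13.4, Serre III.7.9(a), Ferrero–Washington, Lim 3.5}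

Seat `bsd-potss-rkm` g15 (prover; cell `bsd-potss`), item stmt-BirchSwinnertonDyer-19196 `ReducibleKatoMember` = crux M of K9
`KatoDescentPotSupersingular` / K8-t′ `KatoDescentTamePotSupersingular` (`--supports … --as helper`; closes nothing).  HONEST
FRAMING (cell): BSD is not proved by any of this; nothing is booked; crux M stays cite-level on {modularity,
`Kato2004.exists_memberHullZetaInputs`}; this is the IWASAWA-LEVEL half of the road «M ⟸ general facts», NOT the level-0 count.

WHAT.  `charIdeal_quotient_zetaLift_le_charIdeal_fineSelmerDual`: for `W/ℚ` elliptic without CM, `p` odd with `E[p]`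
REDUCIBLE, `W(ℚ)` and `Ш(W)[p^∞]` finite (the rank-0 rows of crux M), the cyclotomic `(κ, γ)`, the pinned `I : IwasawaH1Data`,
ANY dual fine Selmer datum `Y`, a `ZetaBody` family `(f, ι, κ′, Λ′, c, d, a, A, z, x)` for `T_pW` whose `f` is the newform of
a curve `V` with `L(V,1) ≠ 0` and whose data pass the value guards (`κ′ ≠ 0`, `A ≥ 1`, `(cd, A) = 1`, `dd′ ≡ 1 (A)`, non-zero cusp
factor — `Kato2004.valueGuard_satisfiable`), and its Λ-adic lift `𝐲` (`proj n 𝐲 = Cor z_{n+1,∅}`):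
**`char_Λ(𝐇¹_Γ(T_pW)/Λ𝐲) ⊆ char_Λ X₀(W/ℚ_∞)`**, modulo the four named facts.  Assembly of tree theorems only:
`𝐲` is a genuine Euler-system class (`isEulerSystemClass_of_zetaBody`, rkm g15); `𝐲 ≠ 0` from the VALUE
(`MemberIndexOfValue.not_isOfFinAddOrder_proj_zero_of_zetaBody`, rkm g10); `𝐇¹_Γ/Λ𝐲` torsion from (R0)
(`IntegralH1RankZero.rank_integralH1_layerZero_le_one`, rkm g9; `rank_le_one_of_rank_integralH1_le_one`;
`MemberHullRankOne.isTorsion_quotient_span_singleton_of_rank_le_one`); then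
`SmallImageEulerSystemBoundOffP.charIdeal_le_charIdeal_fineSelmerDual_of_not_irreducible` (13.4 (2) off `p` with (v) from Serre;
`μ(X₀) = 0` from FW + Lim 3.5 on the abelian Borel field).
References: [Kato2004Asterisque] Thm. 12.5 (3)–(4), Thm. 12.6 (p. 222), Thm. 13.4 (p. 226), Thm. 14.5 (2) (p. 236);
[Wuthrich2014] Lemma 14 (p. 396); [SilvermanAEC2009] Thm. III.7.9 (a); [Lim2017FineSelmer] §3 Thm. 3.5.
-/

-- the summit and its single problem are both named `BirchSwinnertonDyer` (registry layout D-0017)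
set_option linter.dupNamespace false
set_option autoImplicit false

noncomputable section

open scoped NumberField TensorProduct
open Field IsDedekindDomain WeierstrassCurve
open Literature.NumberTheory.GaloisRepresentations Literature.NumberTheory.EllipticCurves
open Literature.NumberTheory.EllipticCurves.ModularForms
open Literature.NumberTheory.EllipticCurves.Kato2004 Literature.NumberTheory.EllipticCurves.Kato2004.EulerSystemValues

namespace Summit.BirchSwinnertonDyer.BirchSwinnertonDyer.Theorems.ReducibleZetaDivisibility

/-- **`𝐇¹_Γ(T_pW)/Λy` is torsion for `y ≠ 0` on a rank-0 row** (`W(ℚ)`, `Ш(W)[p^∞]` finite; `κ` cyclotomic, `γ` a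
topological generator): `𝐇¹_Γ` is finitely generated, torsion free, of rank `≤ 1` by (R0) + (R2).
[cite: Kato2004Asterisque, Thm. 12.4 (2) (p. 221), Thm. 14.5 (1) (p. 236)] -/
theorem isTorsion_quotient_span_singleton_of_ne_zero (W : WeierstrassCurve ℚ) [W.IsElliptic] (p : ℕ) [Fact p.Prime]
    [ContinuousSMul ℤ_[p] (W.tateModule p)] [Finite W.toAffine.Point]
    [Finite (AddCommGroup.primaryComponent W.sha p)]
    {κ : ZpExtension ℚ p} {γ : absoluteGaloisGroup ℚ} (hκ : κ.IsCyclotomic) (hγ : κ.IsTopGenerator γ)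
    (I : IwasawaH1Data W p κ γ) {y : I.H} (hy0 : y ≠ 0) :
    Module.IsTorsion (IwasawaAlgebra p) (I.H ⧸ Submodule.span (IwasawaAlgebra p) {y}) := by
  haveI := IwasawaH1Data.module_finite_of_isCyclotomic hκ hγ I
  haveI := I.noZeroSMulDivisors hγ
  exact MemberHullRankOne.isTorsion_quotient_span_singleton_of_rank_le_one
    (hF := IwasawaH1Data.rank_le_one_of_rank_integralH1_le_one hκ hγ I
      (IntegralH1RankZero.rank_integralH1_layerZero_le_one W p κ)) (hz := hy0)

/-- **Kato's divisibility for his own zeta class on the REDUCIBLE non-CM rank-0 rows, from general facts.**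
For `W/ℚ` elliptic, non-CM, `p ≠ 2`, `E[p]` reducible, `W(ℚ)` and `Ш(W)[p^∞]` finite, the cyclotomic `(κ, γ)`,
pinned `I`, any fine Selmer dual datum `Y`, a `ZetaBody` family with the value guards (its `f` the newform of a curve `V`
with `L(V,1) ≠ 0`) and its Λ-adic lift `𝐲`: `char_Λ(𝐇¹_Γ(T_pW)/Λ𝐲) ⊆ char_Λ X₀(W/ℚ_∞)` — modulo
{`thm13_4_…`, `serre_adicImage_…`, `ferreroWashington1979_…`, `Lim2017.thm35_…`}.
[cite: Kato2004Asterisque, Thm. 12.5 (3)–(4) (p. 222), Thm. 13.4 (2) (p. 226), Thm. 14.5 (2) (p. 236)]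
[cite: Wuthrich2014, Lemma 14 (p. 396)] [cite: SilvermanAEC2009, Thm. III.7.9 (a)] -/
theorem charIdeal_quotient_zetaLift_le_charIdeal_fineSelmerDual
    (h134 : thm13_4_lengthAt_fineSelmerDual_le_of_isEulerSystemClass)
    (hSerre : serre_adicImage_contains_congruenceSubgroup)
    (hLim : Lim2017.thm35_fineSelmerDual_moduleFinite_of_classicalMuVanishes_of_le_divisionField)
    (hFW : Literature.NumberTheory.IwasawaTheory.ferreroWashington1979_classicalMuVanishes)
    (W : WeierstrassCurve ℚ) [W.IsElliptic] (p : ℕ) [Fact p.Prime]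
    [ContinuousSMul ℤ_[p] (W.tateModule p)] [Module.Free ℤ_[p] (W.tateModule p)]
    [Module.Finite ℤ_[p] (W.tateModule p)]
    [Finite W.toAffine.Point] [Finite (AddCommGroup.primaryComponent W.sha p)]
    {κ : ZpExtension ℚ p} {γ : absoluteGaloisGroup ℚ} (hp : p ≠ 2) (hκ : κ.IsCyclotomic)
    (hγ : κ.IsTopGenerator γ) (hCM : ¬ W.HasCM) (hred : ¬ W.HasIrreducibleModPGaloisRep p)
    (I : IwasawaH1Data W p κ γ) (Y : W.FineSelmerDualData κ γ)
    {N : ℕ} [NeZero N] {f : CuspForm (CongruenceSubgroup.Gamma0 N) 2}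
    {ι : (m : ℕ) → (CyclotomicField m ℚ →+* ℂ)} {κ' : ℝ}
    {Λ' : ∀ (k : ℕ) (r : Finset (HeightOneSpectrum (𝓞 ℚ))),
      H1 (tateRep W p) (cycSubgroup p k r) →ₗ[ℤ_[p]] ℚ_[p] ⊗[ℚ] CyclotomicField (cycLevel p k r) ℚ}
    {c d a : ℤ} {A : ℕ}
    {z : ∀ (k : ℕ) (r : (cyclotomicLevelsRat p (badPlaces c d A N)).Ideals),
      H1 (tateRep W p) ((cyclotomicLevelsRat p (badPlaces c d A N)).level k r.1)}
    {x : ∀ (k : ℕ) (r : (cyclotomicLevelsRat p (badPlaces c d A N)).Ideals),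
      CyclotomicField (cycLevel p k r.1) ℚ}
    (hbody : ZetaBody W p f ι κ' Λ' c d a A z x) (hne : 2 * c.natAbs * d.natAbs * A * N ≠ 0)
    {y : I.H} (hy : ∀ n : ℕ, I.proj n y = levelToLayer W p hκ hp (badPlaces c d A N) n
      (z (n + 1) (cyclotomicLevelsRat p (badPlaces c d A N)).idealOne))
    {V : WeierstrassCurve ℚ} [V.IsElliptic] (hf : IsNewformOf V f) (hL1 : V.entireLFunction 1 ≠ 0)
    (hκ' : κ' ≠ 0) (hA : 0 < A) (d' : ℤ) (hcd : Int.gcd (c * d) A = 1) (hdd' : d * d' ≡ 1 [ZMOD (A : ℤ)])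
    (hR : cuspFactor f true (fun _ ↦ 1) c d a A d' ≠ 0) :
    Module.charIdeal (IwasawaAlgebra p) (I.H ⧸ Submodule.span (IwasawaAlgebra p) {y}) ≤
      Module.charIdeal (IwasawaAlgebra p) Y.X := by
  have hnt : ¬ IsOfFinAddOrder (I.proj 0 y) :=
    MemberIndexOfValue.not_isOfFinAddOrder_proj_zero_of_zetaBody hκ hp hbody hκ' hf hL1 hA d' hcd hdd' hR hy
  have hy0 : y ≠ 0 := by
    rintro rfl
    exact hnt (by rw [map_zero]; exact isOfFinAddOrder_iff_nsmul_eq_zero.mpr ⟨1, one_pos, by simp⟩)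
  exact SmallImageEulerSystemBoundOffP.charIdeal_le_charIdeal_fineSelmerDual_of_not_irreducible h134 hSerre hLim
    hFW W p κ γ hp hκ hγ hCM hred I Y y (isEulerSystemClass_of_zetaBody W p hκ hp I hbody hne hy) hy0
    (isTorsion_quotient_span_singleton_of_ne_zero W p hκ hγ I hy0)

end Summit.BirchSwinnertonDyer.BirchSwinnertonDyer.Theorems.ReducibleZetaDivisibility

end
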